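import Summits.CriticalPhenomena.PercolationContinuityZ3.Theorems.PercNearOneGluingNoHeavyLowerTailKnQuestion8PocketPeel
import Summits.CriticalPhenomena.PercolationContinuityZ3.Theorems.PercNearOneGluingNoHeavyLowerTailKNConj4PreMargin
import Summits.CriticalPhenomena.PercolationContinuityZ3.Theorems.PercNearOneGluingAdditiveGluingCSHHpart
import HarnessLib

/-!
# Kozma–Nitzan's Question 8 at three relays from ONE five-point inequality: (41) ⟸ the two-observer pocket transfer (PS5)

Support file (`--supports stmt-CriticalPhenomena-4575`, closed crux; independent mathematics on Kozma–Nitzan's Question 8,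
arXiv:2401.12397 §5.5 p. 36), prover `prim-ineq-gen-7` (gen 11).  No definitions, no named facts, no sorries; standard axioms.
Memo `run/shared/lean/prim/prim-ineq-gen-7/FINDING-PEELD-g11.md` §3.

Observer `o`, relays `A = {c, k, k'}`, a down-closed pocket family `𝒟 ∋ {o}` none of whose members contains `c` or `k'`
(Question 8: `𝒟 = {W | W ∩ A = ∅}`; Question 8-Z, Question 9 and truncated pockets are other instances), `P = {C_o ∈ 𝒟}`, `F` monotone
on vertex sets, and the POCKET DESIGNATION of `c` against `k`: `∫_P F(C c) ≤ ∫_P F(C k)`.  With the exact peel identity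
(`PreFKGSurplus.preSurplus_erase_add`) and the pocket peel inequality PEEL-D (`PocketCert.peel_of_pocket_relay`, this seat, gen 11),
   `μ(N ∩ P)·Δ_o(A) ≥ μ(N ∩ P)·Δ_o({c,k'}) + μ(N ∩ {k↔o})·(s_k − s_c) − μ(N ∩ {k↔o})·Δ^P_k({c,k'})`,   `N = {k ↮ {c,k'}}`,
where `Δ_o({c,k'}) = ∫_{{k'↮c} ∩ {k'↔o}} (F(C k') − F(C c))` and `Δ^P_k({c,k'}) = ∫_{P ∩ {k'↮c} ∩ {k'↔k}} (F(C k') − F(C c))` is the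
POCKET-RESTRICTED margin of the second observer `k`.  Hence
* `PocketCert.block41_three_of_ps5` — **(41) at `|A| = 3` from (PS5)**: if
     `μ(N ∩ {k↔o}) · ∫_{P ∩ {k'↮c} ∩ {k'↔k}} (F(C k') − F(C c)) ≤ μ(N ∩ P) · ∫_{{k'↮c} ∩ {k'↔o}} (F(C k') − F(C c))`   (PS5)
  then `0 ≤ ∫_{o ↔ A} (F(C o) − F(C c))`, i.e. for `F = 1{b ∈ ·}`: `μ(o ↔ A, c ↔ b) ≤ μ(o ↔ A, o ↔ b)` — Kozma–Nitzan's (41).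
So Question 8 at three relays is reduced in the tree to the single five-point inequality (PS5) (for either labelling `(k, k')` of the
two non-designated relays; only the designation of `c` against the PEELED relay `k` is used), versus the three inequalities
PCOV_x ∧ PCOV_y ∧ (Z*D) of prim-lf-2's `PocketCert.block41_three_of_pcov`.  (PS5) is the memo's PCSH₀ at `Y = {c}` plus the proved
pocket attachment PAC; exact census of the cell: 0 violations (prim-ineq-gen-7 gen 10/11, prim-lf-2 gen 16).
[cite: KozmaNitzan2024, Question 8 (§5.5 p. 36), display (41)] [cite: VandenbergHaggstromKahn2005, Thm. 2.1 (p. 9)]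
-/

namespace Summit.CriticalPhenomena.PercolationContinuityZ3.Theorems

open MeasureTheory Set Literature.Probability.LatticeModels Literature.Probability.Percolation
open scoped Classical
open KNPreFKG

noncomputable section

namespace PocketCert

variable {n : ℕ}

/-- `Δ_o({c}) = 0`: on `{o ↔ c}` the clusters of `o` and `c` coincide. [folklore] -/
theorem preSurplus_singleton_self (w : Sym2 (Fin n) → unitInterval) (F : Set (Fin n) → ℝ) (o c : Fin n) :
    ∫ ω in ⋃ a ∈ ({c} : Finset (Fin n)), openConn o a, (F (openCluster ω o) - F (openCluster ω c)) ∂(prodBernoulli w) = 0 := by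
  have hmeas : ∀ S : Set (BondConfig (Fin n)), MeasurableSet S := fun _ => MeasurableSet.of_discrete
  refine setIntegral_eq_zero_of_forall_eq_zero fun ω hω => ?_
  obtain ⟨a, ha, hoa⟩ := (PreFKGSurplus.mem_iUnion_openConn _ o ω).1 hω
  rw [Finset.mem_singleton] at ha
  subst ha
  rw [PreFKGSurplus.openCluster_eq_of_reach hoa, sub_self]

/-- **Kozma–Nitzan's (41) at `|A| = 3` from the two-observer pocket transfer (PS5).**  Weights `< 1`; `o, c, k, k'` distinct; `𝒟` a
down-closed pocket family containing `{o}` whose members avoid `c, k'`; `P = {C_o ∈ 𝒟}`; `F` monotone; pocket designation of `c`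
against `k`; and (PS5) for the pair `R = {c, k'}` with second observer `k`.  Then `0 ≤ ∫_{o↔{c,k,k'}} (F(C o) − F(C c))`.
[cite: KozmaNitzan2024, Question 8 (§5.5 p. 36), display (41)] [cite: VandenbergHaggstromKahn2005, Thm. 2.1 (p. 9)] -/
theorem block41_three_of_ps5 (w : Sym2 (Fin n) → unitInterval) (hw : ∀ e, w e < 1) (o c k k' : Fin n)
    (hoc : o ≠ c) (hok : o ≠ k) (hok' : o ≠ k') (hck : c ≠ k) (hck' : c ≠ k') (hkk' : k ≠ k')
    (𝒟 : Set (Set (Fin n))) (h𝒟 : IsLowerSet 𝒟) (h𝒟o : ({o} : Set (Fin n)) ∈ 𝒟)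
    (hc𝒟 : ∀ W ∈ 𝒟, c ∉ W) (hk'𝒟 : ∀ W ∈ 𝒟, k' ∉ W)
    (F : Set (Fin n) → ℝ) (hF : ∀ S T : Set (Fin n), S ⊆ T → F S ≤ F T)
    (hdes : ∫ ω in {ω : BondConfig (Fin n) | openCluster ω o ∈ 𝒟}, F (openCluster ω c) ∂(prodBernoulli w) ≤
      ∫ ω in {ω : BondConfig (Fin n) | openCluster ω o ∈ 𝒟}, F (openCluster ω k) ∂(prodBernoulli w))
    (hPS5 : (prodBernoulli w).real ({ω : BondConfig (Fin n) | ∀ y ∈ ({c, k'} : Set (Fin n)), ¬ (openGraph ω).Reachable k y} ∩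
          openConn k o) *
        ∫ ω in {ω : BondConfig (Fin n) | openCluster ω o ∈ 𝒟} ∩ {ω | ¬ (openGraph ω).Reachable k' c} ∩ openConn k' k,
          (F (openCluster ω k') - F (openCluster ω c)) ∂(prodBernoulli w) ≤
      (prodBernoulli w).real ({ω : BondConfig (Fin n) | ∀ y ∈ ({c, k'} : Set (Fin n)), ¬ (openGraph ω).Reachable k y} ∩
          {ω | openCluster ω o ∈ 𝒟}) *
        ∫ ω in {ω : BondConfig (Fin n) | ¬ (openGraph ω).Reachable k' c} ∩ openConn k' o,
          (F (openCluster ω k') - F (openCluster ω c)) ∂(prodBernoulli w)) :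
    0 ≤ ∫ ω in ⋃ a ∈ ({c, k, k'} : Finset (Fin n)), openConn o a, (F (openCluster ω o) - F (openCluster ω c)) ∂(prodBernoulli w) := by
  classical
  set μ := prodBernoulli w with hμ
  have hmeas : ∀ S : Set (BondConfig (Fin n)), MeasurableSet S := fun _ => MeasurableSet.of_discrete
  have hn0 := fun (S' : Set (BondConfig (Fin n))) => (measureReal_nonneg : 0 ≤ μ.real S')
  have hint : ∀ (g : BondConfig (Fin n) → ℝ) (S' : Set (BondConfig (Fin n))), IntegrableOn g S' μ :=
    fun g S' => (Integrable.of_finite).integrableOn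
  set gk : BondConfig (Fin n) → ℝ := fun ω => F (openCluster ω k) - F (openCluster ω c) with hgk
  set gk' : BondConfig (Fin n) → ℝ := fun ω => F (openCluster ω k') - F (openCluster ω c) with hgk'
  set P : Set (BondConfig (Fin n)) := {ω : BondConfig (Fin n) | openCluster ω o ∈ 𝒟} with hP
  set N : Set (BondConfig (Fin n)) := {ω : BondConfig (Fin n) | ∀ y ∈ ({c, k'} : Set (Fin n)), ¬ (openGraph ω).Reachable k y} with hN
  set Ok : Set (BondConfig (Fin n)) := openConn k o with hOk
  -- Step 1: peel `k`, then `k'`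
  have hX1 : ({c, k, k'} : Finset (Fin n)).erase k = {c, k'} := by
    rw [Finset.erase_insert_of_ne hck, Finset.erase_insert (by simpa using hkk')]
  have hX2 : ({c, k'} : Finset (Fin n)).erase k' = {c} := by
    ext a
    simp only [Finset.mem_erase, Finset.mem_insert, Finset.mem_singleton]
    constructor
    · rintro ⟨h1, h2 | h2⟩
      · exact h2
      · exact absurd h2 h1
    · intro h
      rw [h]
      exact ⟨hck', Or.inl rfl⟩
  have peel1 := PreFKGSurplus.preSurplus_erase_add w ({c, k, k'} : Finset (Fin n)) F c k o (by simp)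
  rw [hX1] at peel1
  have peel2 := PreFKGSurplus.preSurplus_erase_add w ({c, k'} : Finset (Fin n)) F c k' o (by simp)
  rw [hX2, preSurplus_singleton_self, zero_add] at peel2
  have hcoe1 : (↑({c, k'} : Finset (Fin n)) : Set (Fin n)) = ({c, k'} : Set (Fin n)) := by simp
  have hcoe2 : (↑({c} : Finset (Fin n)) : Set (Fin n)) = ({c} : Set (Fin n)) := by simp
  rw [hcoe1] at peel1
  rw [hcoe2] at peel2
  -- the second peel's event is `{k'↮c} ∩ {k'↔o}`
  have hev2 : ({ω : BondConfig (Fin n) | ∀ a ∈ ({c} : Set (Fin n)), ¬ (openGraph ω).Reachable k' a} ∩ openConn k' o) =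
      {ω : BondConfig (Fin n) | ¬ (openGraph ω).Reachable k' c} ∩ openConn k' o := by
    ext ω; simp
  rw [hev2] at peel2
  -- so  Δ_o(A) = B₁ + T  with  B₁ = ∫_{{k'↮c}∩{k'↔o}} g_{k'},  T = ∫_{N ∩ {k↔o}} g_k
  set B1 := ∫ ω in {ω : BondConfig (Fin n) | ¬ (openGraph ω).Reachable k' c} ∩ openConn k' o, gk' ω ∂μ with hB1
  set T := ∫ ω in N ∩ Ok, gk ω ∂μ with hT
  have hΔ : ∫ ω in ⋃ a ∈ ({c, k, k'} : Finset (Fin n)), openConn o a, (F (openCluster ω o) - F (openCluster ω c)) ∂μ = B1 + T := by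
    rw [peel1, peel2]
  -- Step 2: PEEL-D for the owner `k`, avoided set `{c, k'}`
  have hY𝒟 : ∀ W ∈ 𝒟, ∀ y ∈ ({c, k'} : Set (Fin n)), y ∉ W := by
    intro W hW y hy
    simp only [mem_insert_iff, mem_singleton_iff] at hy
    rcases hy with rfl | rfl
    · exact hc𝒟 W hW
    · exact hk'𝒟 W hW
  have peelD := peel_of_pocket_relay w o k c ({c, k'} : Set (Fin n)) (by simp) 𝒟 h𝒟 hY𝒟 F F hF hF
  -- peelD : μ(N ∩ Ok) * ∫_{N ∩ P} g_k ≤ μ(N ∩ P) * T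
  -- Step 3: split  ∫_{N ∩ P} g_k = (s_k − s_c) − Δ^P_k({c,k'})
  set s := ∫ ω in P, gk ω ∂μ with hs
  set DP := ∫ ω in P ∩ {ω | ¬ (openGraph ω).Reachable k' c} ∩ openConn k' k, gk' ω ∂μ with hDP
  have hs_nonneg : 0 ≤ s := by
    rw [hs, hgk, integral_sub (hint _ _) (hint _ _)]
    linarith [hdes]
  have hsplit : ∫ ω in N ∩ P, gk ω ∂μ = s - DP := by
    -- pointwise:  1_P g_k = 1_{N ∩ P} g_k + 1_{P ∩ {k'↮c} ∩ {k'↔k}} g_{k'}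
    have hpt : ∀ ω : BondConfig (Fin n), P.indicator gk ω =
        (N ∩ P).indicator gk ω + (P ∩ {ω | ¬ (openGraph ω).Reachable k' c} ∩ openConn k' k).indicator gk' ω := by
      intro ω
      by_cases hp : ω ∈ P
      swap
      · rw [indicator_of_notMem hp, indicator_of_notMem (fun h => hp h.2), indicator_of_notMem (fun h => hp h.1.1), add_zero]
      rw [indicator_of_mem hp]
      by_cases hN' : ω ∈ N
      · rw [indicator_of_mem (show ω ∈ N ∩ P from ⟨hN', hp⟩), indicator_of_notMem, add_zero]
        rintro ⟨⟨-, -⟩, hkk⟩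
        exact hN' k' (by simp) (show (openGraph ω).Reachable k' k from hkk).symm
      · rw [indicator_of_notMem (fun h => hN' h.1), zero_add]
        -- `k` reaches `c` or `k'`
        have hreach : (openGraph ω).Reachable k c ∨ (openGraph ω).Reachable k k' := by
          by_contra hcon
          apply hN'
          intro y hy
          simp only [mem_insert_iff, mem_singleton_iff] at hy
          rcases hy with rfl | rfl
          · exact fun h => hcon (Or.inl h)
          · exact fun h => hcon (Or.inr h)
        by_cases hkc : (openGraph ω).Reachable k c
        · -- then `g_k ω = 0` and the second event fails (`k' ↔ k ↔ c` contradicts `k' ↮ c`, or `k' ↮ k`)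
          have h0 : gk ω = 0 := by rw [hgk]; simp only [PreFKGSurplus.openCluster_eq_of_reach hkc, sub_self]
          rw [h0]
          by_cases hm : ω ∈ P ∩ {ω | ¬ (openGraph ω).Reachable k' c} ∩ openConn k' k
          · exact absurd ((show (openGraph ω).Reachable k' k from hm.2).trans hkc) hm.1.2
          · rw [indicator_of_notMem hm]
        · have hkk : (openGraph ω).Reachable k k' := hreach.resolve_left hkc
          have hk'c : ¬ (openGraph ω).Reachable k' c := fun h => hkc (hkk.trans h)
          have hm : ω ∈ P ∩ {ω | ¬ (openGraph ω).Reachable k' c} ∩ openConn k' k :=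
            ⟨⟨hp, hk'c⟩, (show (openGraph ω).Reachable k' k from hkk.symm)⟩
          rw [indicator_of_mem hm, hgk, hgk']
          simp only [PreFKGSurplus.openCluster_eq_of_reach hkk]
    have hi := integral_congr_ae (μ := μ) (Filter.Eventually.of_forall hpt)
    rw [integral_add (Integrable.of_finite) (Integrable.of_finite), integral_indicator (hmeas _), integral_indicator (hmeas _),
      integral_indicator (hmeas _)] at hi
    rw [hs, hDP]
    linarith
  -- Step 4: positivity of μ(N ∩ P) (the empty configuration lies in it)
  have hpos : 0 < μ.real (N ∩ P) := by
    refine CSH.prodBernoulli_real_pos_of_empty_mem w hw ⟨?_, ?_⟩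
    · intro y hy hreach
      simp only [mem_insert_iff, mem_singleton_iff] at hy
      have hne : k ≠ y := by rcases hy with rfl | rfl <;> [exact hck.symm; exact hkk']
      rw [SimpleGraph.reachable_iff_reflTransGen] at hreach
      rcases hreach.cases_head with h | ⟨z, hadj, -⟩
      · exact hne h
      · exact ((openGraph_adj _ k z).1 hadj).1
    · show openCluster (∅ : BondConfig (Fin n)) o ∈ 𝒟
      have : openCluster (∅ : BondConfig (Fin n)) o = {o} := by
        ext z
        simp only [openCluster, mem_setOf_eq, mem_singleton_iff]
        constructor
        · intro h
          rw [SimpleGraph.reachable_iff_reflTransGen] at h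
          rcases h.cases_head with h | ⟨y, hadj, -⟩
          · exact h.symm
          · exact absurd ((openGraph_adj _ o y).1 hadj).1 (Set.notMem_empty _)
        · rintro rfl; exact SimpleGraph.Reachable.refl _
      rw [this]; exact h𝒟o
  -- Step 5: assembly
  rw [hsplit] at peelD
  have key : 0 ≤ μ.real (N ∩ P) * (B1 + T) := by
    have h1 : μ.real (N ∩ Ok) * (s - DP) ≤ μ.real (N ∩ P) * T := peelD
    have h2 : μ.real (N ∩ Ok) * DP ≤ μ.real (N ∩ P) * B1 := hPS5
    nlinarith [mul_nonneg (hn0 (N ∩ Ok)) hs_nonneg]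
  rw [hΔ]
  exact (mul_nonneg_iff_of_pos_left hpos).1 key

end PocketCert

end

end Summit.CriticalPhenomena.PercolationContinuityZ3.Theorems
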